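import Summits.ResolutionOfSingularities.ResolutionOfSingularities.Theses.FrobeniusLadder
import Summits.ResolutionOfSingularities.ResolutionOfSingularities.Theorems.FrobeniusLadderFInjectiveMacaulayficationTrFull
import Summits.ResolutionOfSingularities.ResolutionOfSingularities.Theorems.FrobeniusLadderFInjectiveMacaulayficationOfTrRungs
import HarnessLib

/-!
# Crux `FInjectiveMacaulayfication` (stmt-ResolutionOfSingularities-15315) — SKELETON v40 «LOCAL-FULL DOOR»
# (res-L1-w45a-plan-1 RULING R18.9 (3) «DOOR OUTLOOK: when O4 (c) lands with `_of` by name and tri-2 V-READ PASSes, the desk WILL rule on v40 as THE registered skeleton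
# (v38 `4c41af8f694fab1a` and v39-FL `5c135696462bf937` kept by evidence for revert)»; text prepared by res-L1-w45a-stub-3 g9 over `TrFull` (O4 (c)) for
# res-L1-w45a-tri-2's V-READ and res-L1-w45a-lead-1's registration; the registrar amends the header to the mode the desk rules — skeleton or evidence)

[OURS · L1 W4.5a] THE REGISTERED SKELETON (res-L1-w45a-plan-1 RULING R18.11 (A) «GO AS THE REGISTERED SKELETON»; `ledger skeleton check … --crux stmt-ResolutionOfSingularities-15315` run by the registrar res-L1-w45a-lead-1 g8 on these bytes; v38 `Lines/Sketch.lean` 4c41af8f694fab1a and v39-FL `Lines/full_ladder.lean` 5c135696462bf937 stay lines of record by evidence); sorries ONLY in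
`stub_*`; the deciding theorem `FInjectiveMacaulayfication_of` (alias `FInjectiveMacaulayfication_proof`) concludes the route decl BY NAME. AI-written (AI review is weaker
than expert review).

THE LINE. v38 factors the crux through four published theorems, the resolution rungs T(p,e,1) = `ClosedPointLocalResolutionAdmTr p e 1` (e ≥ 4) and the F-half; v39-FL
through `ResolutionFullTr p e 1`. res-L1-w45a-stub-3 g9's T-SIDE CALIBRATION SQUARE (kernel: p612760 `TrOfResolution`, p613542 `TrOfResolutionFull`, p615457 `ResolutionOfTr`,
`TrFull`): modulo the prints (and the F-half for the last arrow) the four families are EQUIVALENT level by level —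
  {T} ⟸ {ResolutionTr} (`closedPointLocalResolutionAdmTr_of_resolutionTr`) ⟸ {FullBlowupTr ∧ ResolutionFullTr} (`resolutionTr_of_fullBlowup_of_resolutionFull`;
  `FullBlowupTr` from prints ∧ T(<e) ∧ F(e)) ⟸ {T_FULL} (`TrFull.resolutionFullTr_of_trFull`: Temkin's OWN Noetherian induction run on the FULL variety — no patching,
  no alternation with the F-half) ⟸ {T} (restriction, `trFull_of_tr`); and {ResolutionTr} ⟺ {T} directly (`ResolutionOfTr.resolutionTr_iff_tr`).
The registered residue is therefore lettered in its KERNEL-WEAKEST form (R18.7 criterion): **T_FULL(p,e,1) = `TrFull.ClosedPointLocalResolutionFullTr p e 1`, e ≥ 4 —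
at a CLOSED point `y` with FULL (locally integral ∧ Cohen–Macaulay ∧ parameter ideals Frobenius-closed, i.e. F-injective CM) local ring of an integral separated
finite-type e-fold `Y` over `k(s)` (ONE transcendental, `k` any field of characteristic `p`), every ADMISSIBLE blowing up `S′ → Spec 𝒪_{Y,y}` whose singular points lie on
the closed fibre admits a desingularization (Temkin Def. 2.2.6)** — T's body VERBATIM plus the single conjunct `FullCl p (Y.presheaf.stalk y)` on the base germ
(nothing is asked of `S′` beyond T). `r = 1` carries all `r ≥ 1` (`trFull_mono`, res-L1-w45a-lead-1's tower isomorphism).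
RESIDUE READING: «crux ⟸ {CP 2019 Thm 1.1, Stacks 081R, CP 2019 Prop 4.4, Česnavičius 2021 Thm 5.3 (B)} ∧ F-half `LocalFInjectivizationFibreAdmGe4` ∧ T_FULL(p,e,1), e ≥ 4»
— LOCAL and FULL: after the F-half the resolution side never sees a non-FULL germ, and it only ever needs Temkin's condition (iii) at CLOSED FULL germs. PER DIMENSION:
dim ≤ 4 ⟸ prints ∧ F(4) (no resolution input, unchanged); dim ≤ 5 ⟸ prints ∧ F(4) ∧ F(5) ∧ T_FULL(p,4,1) (`TrOfResolutionFull.…_dimLe5_…_of_resolutionFull41_of_F45` ∘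
`resolutionFullTr_of_trFull` at e = 4, where no lower level is consumed).
HONEST CAVEATS: T_FULL is weaker than T and than ResolutionFullTr IN LETTER ONLY — equivalent modulo prints ∧ F-half (square above); open for every e ≥ 4; FULL ⊋ F-rational,
so this is NOT rung `FRationalResolution` (stmt-…-15317); route-level reading (kernel p614714 `AdmRungs`): the resolution side ⟸ the route's own rungs #3/#4 one dimension
down TAKEN ADMISSIBLY. KILL TEST: no stub known false; K4.5 ALIVE. Dossier: `Lines/local-full.md`.
REGISTRAR NOTE (res-L1-w45a-lead-1 g8): these bytes = res-L1-w45a-stub-3 g9ʼs V-READ-passed draft `afa2437927180307` with (i) this header set to the ruled mode and (ii) the two sorry-free AUDIT TWINS `FInjectiveMacaulayfication_of_v38_residue` / `FInjectiveMacaulayfication_via_v38` MOVED VERBATIM to the companion workfile `Lines/local_full_twins.lean` — `#h21_check_skeleton` (HarnessLib/Audit/Check.lean, `checkSkeletonCore`) analyses the FIRST crux-concluding theorem in environment fold order, and a twin carrying `Prop` binders there fails `skeleton.extra-hypothesis`; nothing else changed (stubs and `_of` byte-identical).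
-/

-- single-problem summit: the doubled namespace component is forced
set_option linter.dupNamespace false

noncomputable section

namespace Summit.ResolutionOfSingularities.ResolutionOfSingularities.Cruxes.FInjectiveMacaulayfication.LocalFull

open AlgebraicGeometry CategoryTheory Literature.AlgebraicGeometry.Resolution

/-- NAMED FACTS BY NAME (the ONE named-fact stub, NEVER a prover target; byte-identical to v38's / v39-FL's): Cossart–Piltant 2019 Thm 1.1 (`CossartPiltant2019General`) ·
Raynaud–Gruson flattening = Stacks 081R (`Stacks081R`) · Cossart–Piltant 2019 Prop 4.4 (`CossartPiltant2019Principalization`) · Česnavičius 2021 Thm 5.3 reading (B)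
(`CesnaviciusBlowupMacaulayficationOffClosed`, Literature p602953, admitted DR-CZ3). [cite: CossartPiltant2019, Thm. 1.1; Prop. 4.4] [cite: StacksProject, Tag 081R]
[cite: Cesnavicius2021, Thm. 5.3] -/
theorem stub_namedFacts :
    Literature.AlgebraicGeometry.Resolution.CossartPiltant2019General.{0} ∧ Literature.AlgebraicGeometry.Resolution.Stacks081R.{0} ∧ Literature.AlgebraicGeometry.Resolution.CossartPiltant2019Principalization.{0} ∧
      Literature.AlgebraicGeometry.Resolution.CesnaviciusBlowupMacaulayficationOffClosed.{0} := by
  sorry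

/-- STUB (T_FULL) — **CLOSED-POINT ADMISSIBLE LOCAL RESOLUTION OF FULL GERMS OF `e`-FOLDS, `e ≥ 4`, OVER `k(s)` (ONE TRANSCENDENTAL)**
(`TrFull.ClosedPointLocalResolutionFullTr p e 1` BY NAME, res-L1-w45a-stub-3 g9): for every prime `p`, every `e ≥ 4`, every field `k` of characteristic `p`, every INTEGRAL
separated finite-type scheme `Y` over `K := FractionRing (MvPolynomial (Fin 1) k)` with `dim Y = e`, every CLOSED point `y ∈ Y` whose local ring is FULL
(`SliceableCentre.FullCl p`: domain ∧ every s.o.p. weakly regular ∧ parameter ideals Frobenius-closed): every blowing up `S′ → Spec 𝒪_{Y,y}` along an ADMISSIBLE centre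
(`supp I ⊆ (Reg Spec 𝒪_{Y,y})ᶜ`) whose singular points lie on the closed fibre admits a desingularization (`Scheme.AdmitsDesingularization`). IMPLIED by v38's stub
(restriction, `TrFull.trFull_of_tr`) and by v39-FL's (given the prints: `resolutionFullTr` ⇒ T ⇒ T_FULL); implies both back given the prints and the F-half
(`TrFull.resolutionFullTr_of_trFull`, `tr_le_of_prints_of_F_of_trFull`). Vacuous on 4-folds; on 5-folds exactly T_FULL(p,4,1). Open for every `e ≥ 4`.
[conjecture · OURS · v40 stub] -/
theorem stub_closedPointLocalResolutionFullTr :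
    ∀ p e : ℕ, p.Prime → 4 ≤ e →
      Summit.ResolutionOfSingularities.ResolutionOfSingularities.Theorems.FInjectiveMacaulayfication.TrFull.ClosedPointLocalResolutionFullTr p e 1 := by
  sorry

/-- STUB (F_adm) — **LOCAL F-INJECTIVIZATION OF COHEN–MACAULAY ADMISSIBLE BLOW-UPS AT CLOSED SINGULAR POINTS, FIBRE-SUPPORTED CENTRE, EVERY LOCAL DIMENSION d ≥ 4**
(`LocalFullificationFibreAdmGe4Split.LocalFInjectivizationFibreAdmGe4` BY NAME, res-L1-w45a-stub-2 p591179; byte-identical to v38's / v39-FL's stub): at a CLOSED point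
`x ∉ Reg X` with `dim 𝒪_{X,x} = d ≥ 4` (`X` integral separated f.t./k, char p), a blowing up `S′` of `Spec 𝒪_{X,x}` along `I ≠ ⊥` with `supp I ⊆ (Reg Spec 𝒪_{X,x})ᶜ`,
regular off its closed fibre and Cohen–Macaulay at EVERY point, admits `𝓚 ≠ ⊥` supported in the closed fibre all of whose blowing ups are FULL at every point. Positive
kernel rows: three informative F(4)-iso rows at p = 2 (P2d4C, P2d4F5, P2d4B), T⁽⁴⁾/7, Fermat cubic cones; F(4)-pos: τ-tower floor 1 (evidence + kernel (i)); no
counterexample known. [conjecture · OURS · v37/v38/v39-FL/v40 stub] -/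
theorem stub_localFInjectivizationFibreAdmGe4 :
    Summit.ResolutionOfSingularities.ResolutionOfSingularities.Theorems.FInjectiveMacaulayfication.LocalFullificationFibreAdmGe4Split.LocalFInjectivizationFibreAdmGe4 := by
  sorry

/-- **THE DECIDING THEOREM (v40, local-FULL door)**: the crux `FInjectiveMacaulayfication` BY NAME from the named bundle `stub_namedFacts` (CP 1.1, 081R, CP 4.4,
Česnavičius 5.3 (B)), the F-half (F_adm) and the local-FULL rungs (T_FULL at `r = 1`), by res-L1-w45a-stub-3's
`TrFull.fInjectiveMacaulayfication_of_prints_of_LFadmF_of_trFullOne` (Temkin's induction on the FULL variety ∘ the F-ladder split's strong induction on the level ∘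
v38's assembly `OfTrRungs.fInjectiveMacaulayfication_of_trRungs_of_cesnaviciusOffClosed`). [OURS assembly; v40] -/
theorem FInjectiveMacaulayfication_of :
    Summit.ResolutionOfSingularities.ResolutionOfSingularities.Theses.FrobeniusLadder.FInjectiveMacaulayfication :=
  Summit.ResolutionOfSingularities.ResolutionOfSingularities.Theorems.FInjectiveMacaulayfication.TrFull.fInjectiveMacaulayfication_of_prints_of_LFadmF_of_trFullOne
    stub_namedFacts.1 stub_namedFacts.2.1 stub_namedFacts.2.2.1 stub_namedFacts.2.2.2
    stub_localFInjectivizationFibreAdmGe4 stub_closedPointLocalResolutionFullTr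

/-- The same deciding term under v38's name convention. [OURS assembly; v40] -/
theorem FInjectiveMacaulayfication_proof :
    Summit.ResolutionOfSingularities.ResolutionOfSingularities.Theses.FrobeniusLadder.FInjectiveMacaulayfication :=
  FInjectiveMacaulayfication_of

end Summit.ResolutionOfSingularities.ResolutionOfSingularities.Cruxes.FInjectiveMacaulayfication.LocalFull

end
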